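import Mathlib.Probability.Moments.Covariance
import Summits.Ventures.YMGap.Thresholds.SharpClusteringDecay
import Summits.Ventures.YMGap.Thresholds.SharpClusteringWilson
import Summits.Ventures.YMGap.Thresholds.SharpPoincare
import HarnessLib

/-!
# Venture YMGap — static exponential clustering, Part IV-a:
# exponential decay of covariances on every torus, uniformly in the volume

HONEST FRAMING: venture file (cell `pub-ymgap`, track (a), seat lit-1). Lattice, strong coupling
('t Hooft `|β| < 1/(2Λ₀)`); nothing about the continuum. This file instantiates the generic decay
estimate of Part III-b (`cov_exp_decay_of_distFun`, built on `covariance_le`) for the Wilson action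
on the torus `Λ_L = (ℤ/L)^d`,
`L ≥ 2`: the potential is p2's `wilsonPot d N L β` (`HessBound` with `Λ = N|β|Λ₀` from the tree's
torus Hessian bound `WilsonHessianBound d N Λ₀`, `hessBound_wilsonPot`), the termwise cross-link
bounds are ds-2's `offDiagHessBound_wilsonPot` with `h = wilsonH` (row sums `≤ 6(d-1)N|β|`,
supported on plaquette neighbours), and the weights are `w_e = e^{2κ D(e)}` for any `ℕ`-valued `D`
that is `1`-Lipschitz across plaquette neighbours (admissible with `ρ = e^{2κ}`). With
`κ = min 1 (K/(4H₊+1))`, `K = N/2 - N|β|Λ₀ > 0`, `H₊ = max(6(d-1)N|β|, 0)`, one has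
`K_c = K - (e^κ - 1)H₊ ≥ K/2`, whence (`torus_cov_le_of_distFun`, `torus_covariance_exp_decay`):

  for all smooth `u, v` on `(E⁺(Λ_L) → M_N(ℂ))` that are `δu_e`- resp. `δv_e`-Lipschitz in the link `e`
  on `SU(N)^{E⁺}` and whose Lipschitz data are carried by links whose base points are `≥ m` apart
  in the periodic sup-norm,
  `|Cov_{μ_{Λ_L,Nβ}}(u,v)| ≤ (2/K) e^{-κ m} (Σ_e δu_e)(Σ_e δv_e)`,

with `κ = κ(d,N,β,Λ₀) > 0` and `2/K` INDEPENDENT of `L`. The passage to infinite-volume (tight) limits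
and to Lipschitz cylinder functions (`SZZExponentialClustering`) is Part IV-b (seat ds-2,
`SharpClusteringLimit.lean`).

## References

* H. Shen, R. Zhu, X. Zhu, CMP 400 (2023) 805–851, Cor. 4.11 / Remark 4.12 (statement re-proved here
  statically, with rate `κ(K, N, d)`).
-/

noncomputable section

open scoped Matrix ComplexConjugate BigOperators Matrix.Norms.Frobenius ContDiff Topology ProbabilityTheory
open Matrix Complex Finset MeasureTheory Filter ProbabilityTheory
open Literature.MathematicalPhysics.QuantumFieldTheory
open Literature.MathematicalPhysics.QuantumLattice (fundamentalRep continuous_fundamentalRep)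
open Literature.MathematicalPhysics.QuantumFieldTheory.SUNBakryEmery (SUN FrameIdx frame)

namespace Summit.Ventures.YMGap

namespace SharpClustering

open LatticeBakryEmery

universe u

/-! ### The torus theorem -/

section Torus

variable {d N : ℕ} {L : ℕ} [NeZero L]

/-- Torus expectations at tree coupling `Nβ` as `e^{wilsonPot}`-weighted Haar averages: the
covariance in unnormalised form. -/
theorem covariance_wilsonMeasure_eq (β : ℝ) {u v : Cfg (Edge d L) N → ℝ} (hu : ContDiff ℝ ∞ u)
    (hv : ContDiff ℝ ∞ v) :
    cov[fun U => u (emb U), fun U => v (emb U);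
        wilsonMeasure (d := d) (L := L) (fundamentalRep (Fin N)) ((N : ℝ) * β)] =
      ((∫ U, Real.exp (wilsonPot d N L β (emb U)) ∂(haarPi (Edge d L) N)) *
          (∫ U, Real.exp (wilsonPot d N L β (emb U)) * (u (emb U) * v (emb U)) ∂(haarPi (Edge d L) N)) -
        (∫ U, Real.exp (wilsonPot d N L β (emb U)) * u (emb U) ∂(haarPi (Edge d L) N)) *
          (∫ U, Real.exp (wilsonPot d N L β (emb U)) * v (emb U) ∂(haarPi (Edge d L) N))) /
        (∫ U, Real.exp (wilsonPot d N L β (emb U)) ∂(haarPi (Edge d L) N)) ^ 2 := by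
  set μ := wilsonMeasure (d := d) (L := L) (fundamentalRep (Fin N)) ((N : ℝ) * β) with hμ
  haveI := isProbabilityMeasure_wilsonMeasure (d := d) (L := L) (fundamentalRep (Fin N))
    (continuous_fundamentalRep (n := Fin N)) ((N : ℝ) * β)
  set Z : ℝ := ∫ U, Real.exp (wilsonPot d N L β (emb U)) ∂(haarPi (Edge d L) N) with hZ
  have hSc : Continuous fun U : PSU (Edge d L) N => wilsonPot d N L β (emb U) :=
    continuous_restrict (contDiff_wilsonPot β)
  have hZpos : 0 < Z := integral_exp_pos (integrable_of_continuous_PSU (Real.continuous_exp.comp hSc) _)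
  obtain ⟨Cu, -, hCu⟩ := exists_bound_restrict (ι := Edge d L) hu
  obtain ⟨Cv, -, hCv⟩ := exists_bound_restrict (ι := Edge d L) hv
  have hmu : MemLp (fun U : PSU (Edge d L) N => u (emb U)) 2 μ :=
    MemLp.of_bound (continuous_restrict hu).aestronglyMeasurable Cu
      (ae_of_all _ fun U => by rw [Real.norm_eq_abs]; exact hCu U)
  have hmv : MemLp (fun U : PSU (Edge d L) N => v (emb U)) 2 μ :=
    MemLp.of_bound (continuous_restrict hv).aestronglyMeasurable Cv
      (ae_of_all _ fun U => by rw [Real.norm_eq_abs]; exact hCv U)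
  rw [covariance_eq_sub hmu hmv]
  have e1 : ∫ U, ((fun U : PSU (Edge d L) N => u (emb U)) * fun U => v (emb U)) U ∂μ =
      (∫ U, Real.exp (wilsonPot d N L β (emb U)) * (u (emb U) * v (emb U)) ∂(haarPi (Edge d L) N)) / Z :=
    integral_wilsonMeasure_eq_div β _
  have e2 : ∫ U, u (emb U) ∂μ = (∫ U, Real.exp (wilsonPot d N L β (emb U)) * u (emb U) ∂(haarPi (Edge d L) N)) / Z :=
    integral_wilsonMeasure_eq_div β _
  have e3 : ∫ U, v (emb U) ∂μ = (∫ U, Real.exp (wilsonPot d N L β (emb U)) * v (emb U) ∂(haarPi (Edge d L) N)) / Z :=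
    integral_wilsonMeasure_eq_div β _
  rw [e1, e2, e3]
  field_simp

/-- **Exponential decay of covariances on the torus from an abstract distance function.** Let
`D : E⁺(Λ_L) → ℕ` be `1`-Lipschitz across plaquette neighbours, `= 0` on the links carrying `v`'s
Lipschitz data and `≥ m` on the links carrying `u`'s. Then
`|Cov_{μ_{Λ_L,Nβ}}(u,v)| ≤ (2/K) e^{-κ m} (Σ δu)(Σ δv)`, `κ = min 1 (K/(4H₊+1))`. -/
theorem torus_cov_le_of_distFun {Λ₀ : ℝ} (hH : WilsonHessianBound d N Λ₀) (hN : N ≠ 0) (β : ℝ)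
    (hK : 0 < (N : ℝ) / 2 - N * |β| * Λ₀) (hL : 1 < L)
    {u v : Cfg (Edge d L) N → ℝ} (hu : ContDiff ℝ ∞ u) (hv : ContDiff ℝ ∞ v)
    {δu δv : Edge d L → ℝ} (hδu : ∀ e, 0 ≤ δu e) (hδv : ∀ e, 0 ≤ δv e)
    (hLu : LinkLipschitz u δu) (hLv : LinkLipschitz v δv)
    (D : Edge d L → ℕ) (hD : ∀ e e', e' ∈ linkNbrT e → D e ≤ D e' + 1)
    (hDv : ∀ e, δv e ≠ 0 → D e = 0) {m : ℕ} (hDu : ∀ e, δu e ≠ 0 → m ≤ D e) :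
    |cov[fun U => u (emb U), fun U => v (emb U);
        wilsonMeasure (d := d) (L := L) (fundamentalRep (Fin N)) ((N : ℝ) * β)]| ≤
      2 / ((N : ℝ) / 2 - N * |β| * Λ₀) *
        Real.exp (-(min 1 (((N : ℝ) / 2 - N * |β| * Λ₀) / (4 * max (6 * ((d : ℝ) - 1) * N * |β|) 0 + 1))) * m) *
        (∑ e, δu e) * (∑ e, δv e) := by
  set K : ℝ := (N : ℝ) / 2 - N * |β| * Λ₀ with hKdef
  set Hp : ℝ := max (6 * ((d : ℝ) - 1) * N * |β|) 0 with hHp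
  have hHp0 : 0 ≤ Hp := le_max_right _ _
  set S := wilsonPot d N L β with hS
  have hSc : Continuous fun U : PSU (Edge d L) N => S (emb U) := continuous_restrict (contDiff_wilsonPot β)
  set Z : ℝ := ∫ U, Real.exp (S (emb U)) ∂(haarPi (Edge d L) N) with hZ
  have hZpos : 0 < Z := integral_exp_pos (integrable_of_continuous_PSU (Real.continuous_exp.comp hSc) _)
  have hgen := cov_exp_decay_of_distFun (ι := Edge d L) hN (wilsonPot_mem_polySpace (d := d) (N := N) (L := L) β)
    (hessBound_wilsonPot hH β) hK (offDiagHessBound_wilsonPot hL β) (wilsonH_nonneg N β) (wilsonH_symm N β)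
    hHp0 (fun e => (sum_wilsonH_le N β e).trans (le_max_left _ _)) D
    (fun e e' hne => hD e e' (mem_linkNbrT_of_wilsonH_ne_zero N hne)) hu hv hδu hδv hLu hLv hDv hDu
  rw [covariance_wilsonMeasure_eq β hu hv, abs_div, abs_of_pos (pow_pos hZpos 2), div_le_iff₀ (pow_pos hZpos 2)]
  refine hgen.trans (le_of_eq ?_)
  ring

/-- **Exponential decay of covariances on every torus, uniformly in the volume** (the torus half
of Shen–Zhu–Zhu's Cor. 4.11, re-proved statically with the Hessian constant `Λ₀` as a parameter):
there is `κ = κ(d,N,β,Λ₀) > 0` such that for every torus side `L ≥ 2`, all smooth `u, v` with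
per-link Lipschitz data `δu, δv ≥ 0` on `SU(N)^{E⁺(Λ_L)}` carried by links whose base points are
`≥ m` apart (periodic sup-norm),
`|Cov_{μ_{Λ_L,Nβ}}(u,v)| ≤ (2/K) e^{-κ m} (Σ_e δu_e)(Σ_e δv_e)`, `K = N/2 - N|β|Λ₀ > 0`. -/
theorem torus_covariance_exp_decay {d N : ℕ} {Λ₀ : ℝ} (hH : WilsonHessianBound d N Λ₀) (hN : N ≠ 0) (β : ℝ)
    (hK : 0 < (N : ℝ) / 2 - N * |β| * Λ₀) :
    ∃ κ : ℝ, 0 < κ ∧ ∀ (L : ℕ) [NeZero L], 1 < L →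
      ∀ (u v : Cfg (Edge d L) N → ℝ), ContDiff ℝ ∞ u → ContDiff ℝ ∞ v →
      ∀ (δu δv : Edge d L → ℝ), (∀ e, 0 ≤ δu e) → (∀ e, 0 ≤ δv e) →
        LinkLipschitz u δu → LinkLipschitz v δv →
      ∀ (m : ℕ), (∀ e e', δu e ≠ 0 → δv e' ≠ 0 → m ≤ torusNorm (e.1 - e'.1)) →
        |cov[fun U => u (emb U), fun U => v (emb U);
            wilsonMeasure (d := d) (L := L) (fundamentalRep (Fin N)) ((N : ℝ) * β)]| ≤
          2 / ((N : ℝ) / 2 - N * |β| * Λ₀) * Real.exp (-κ * m) * (∑ e, δu e) * (∑ e, δv e) := by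
  set K : ℝ := (N : ℝ) / 2 - N * |β| * Λ₀ with hKdef
  set Hp : ℝ := max (6 * ((d : ℝ) - 1) * N * |β|) 0 with hHp
  have hHp0 : 0 ≤ Hp := le_max_right _ _
  refine ⟨min 1 (K / (4 * Hp + 1)), rate_pos hK hHp0, ?_⟩
  intro L _ hL u v hu hv δu δv hδu hδv hLu hLv m hsep
  classical
  set Sv : Finset (Edge d L) := univ.filter fun e => δv e ≠ 0 with hSv
  by_cases hne : Sv.Nonempty
  · -- distance to the support of `v`'s Lipschitz data
    set D : Edge d L → ℕ := fun e => Sv.inf' hne fun e' => torusNorm (e.1 - e'.1) with hD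
    have hD1 : ∀ e e', e' ∈ linkNbrT e → D e ≤ D e' + 1 := by
      intro e e' he'
      obtain ⟨s, hs, hDs⟩ := exists_mem_eq_inf' hne (fun e'' => torusNorm (e'.1 - e''.1))
      have h1 : D e ≤ torusNorm (e.1 - s.1) := inf'_le _ hs
      have h2 : torusNorm (e.1 - s.1) ≤ torusNorm (e.1 - e'.1) + torusNorm (e'.1 - s.1) := torusNorm_sub_le _ _ _
      have h3 : torusNorm (e.1 - e'.1) ≤ 1 := torusNorm_sub_le_one_of_mem_linkNbrT he'
      have h4 : D e' = torusNorm (e'.1 - s.1) := hDs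
      omega
    have hDv : ∀ e, δv e ≠ 0 → D e = 0 := by
      intro e he
      have hmem : e ∈ Sv := by rw [hSv]; exact mem_filter.2 ⟨mem_univ _, he⟩
      have h1 : D e ≤ torusNorm (e.1 - e.1) := inf'_le _ hmem
      rw [sub_self, torusNorm_zero] at h1
      exact Nat.le_zero.1 h1
    have hDu : ∀ e, δu e ≠ 0 → m ≤ D e := by
      intro e he
      refine (le_inf'_iff hne _).2 fun e' he' => ?_
      have h1 : e' ∈ univ.filter (fun e => δv e ≠ 0) := by rw [hSv] at he'; exact he'
      exact hsep e e' he (mem_filter.1 h1).2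
    exact torus_cov_le_of_distFun hH hN β hK hL hu hv hδu hδv hLu hLv D hD1 hDv hDu
  · -- `v` carries no Lipschitz data: both sides vanish
    have hδv0 : ∀ e, δv e = 0 := by
      intro e
      by_contra h
      exact hne ⟨e, by rw [hSv]; exact mem_filter.2 ⟨mem_univ _, h⟩⟩
    have h0 := torus_cov_le_of_distFun hH hN β hK hL hu hv hδu hδv hLu hLv (fun _ => 0)
      (fun _ _ _ => by simp) (fun _ _ => rfl) (m := 0) (fun _ _ => le_rfl)
    have hs0 : ∑ e, δv e = 0 := sum_eq_zero fun e _ => hδv0 e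
    rw [hs0, mul_zero] at h0 ⊢
    exact h0

end Torus

end SharpClustering

end Summit.Ventures.YMGap
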